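import Literature.Analysis.Matrix.KyFanMaximumPrinciple
import HarnessLib

/-!
# The top eigenvalue of a block-diagonal symmetric matrix is the largest of the blocks' top eigenvalues

Horn–Johnson, *Matrix Analysis* (2nd ed., CUP 2013), **1.1.P4** (held text
`book:horn2012-matrix-analysis` p0076): for a block diagonal `A = A₁₁ ⊕ A₂₂`,

> Show that `σ(A) = σ(A₁₁) ∪ σ(A₂₂)`.

together with the Rayleigh principle **Thm 4.2.2 (c)** (p0303) and Cauchy interlacing **Thm 4.3.28**
(p0315).  Here, for a REAL SYMMETRIC `A : Matrix ι ι ℝ` that is block diagonal with respect to a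
labelling `c : ι → κ` of the indices (`A i j = 0` whenever `c i ≠ c j`; the blocks are the principal
submatrices `A.submatrix Subtype.val Subtype.val` on the fibres `{i // c i = k}`), the consequence for
the LARGEST eigenvalue `λ↓₀` (Mathlib's antitone `eigenvalues₀`):

* `dotProduct_mulVec_eq_sum_blocks` — the quadratic form splits over the blocks,
  `xᵀAx = Σ_k (x|ₖ)ᵀ A_k (x|ₖ)`;
* `eigenvalues₀_zero_le_of_blocks` / `eigenvalues₀_zero_le_of_block_tops` — `λ↓₀(A) ≤ B` as soon as
  every block's form (resp. every non-empty block's top eigenvalue) is `≤ B`;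
* `block_top_le_eigenvalues₀_zero` — each non-empty block's top eigenvalue is `≤ λ↓₀(A)` (interlacing;
  no block structure needed);
* `eigenvalues₀_zero_mem_Icc_of_block_tops` — **certificate form**: enclosures `[loₖ, hiₖ]` of the block
  tops give `λ↓₀(A) ∈ [max loₖ, max hiₖ]` (stated with one block attaining the lower end and a common
  upper bound).

This is the door of the step "top eigenvalue of a symmetry SECTOR = max over its symmetry blocks of the
certified block tops" used by every transfer-matrix lineage that solves the ±1-character blocks
separately and reports sector energies.  Everything is proved; no definitions, no named facts.
NOT here: the full multiset statement `σ(A) = ⋃ σ(A_k)` with multiplicities / the other indices.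

## References
* [HornJohnson2013] R. A. Horn, C. R. Johnson, *Matrix Analysis*, 2nd ed., CUP 2013 — 1.1.P4 (p0076),
  Thm 4.2.2 (c) (p0303), Thm 4.3.28 (p0315).
-/

noncomputable section

open scoped Matrix

namespace Literature.Analysis.Matrix

namespace BlockDiagonalTop

open Finset _root_.Matrix KyFan

variable {ι κ : Type*} [Fintype ι] [DecidableEq ι] [Fintype κ] [DecidableEq κ]

omit [DecidableEq ι] [Fintype κ] [DecidableEq κ] in
/-- A sum over `ι` of a function vanishing off a decidable predicate is the sum over the subtype.
[folklore] -/
private theorem sum_eq_sum_subtype {p : ι → Prop} [DecidablePred p] (f : ι → ℝ)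
    (hf : ∀ i, ¬ p i → f i = 0) : ∑ i, f i = ∑ i : {i // p i}, f i := by
  rw [← Finset.sum_filter_of_ne (p := p) (fun i _ hi => by by_contra h; exact hi (hf i h))]
  exact Finset.sum_subtype (univ.filter p) (fun i => by simp) f

omit [DecidableEq ι] in
/-- Any dot product splits over the fibres of a labelling `c : ι → κ`:
`x ⬝ y = Σ_k (x|ₖ) ⬝ (y|ₖ)`. [folklore] -/
private theorem dotProduct_eq_sum_blocks (c : ι → κ) (x y : ι → ℝ) :
    x ⬝ᵥ y = ∑ k, (fun i : {i // c i = k} => x i) ⬝ᵥ (fun i : {i // c i = k} => y i) := by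
  simp only [dotProduct]
  exact (Fintype.sum_fiberwise c (fun i => x i * y i)).symm

omit [DecidableEq ι] in
/-- **The quadratic form of a block-diagonal matrix splits over the blocks**:
`xᵀAx = Σ_k (x|ₖ)ᵀ A[k] (x|ₖ)` when `A i j = 0` for `c i ≠ c j` (HJ §0.9.2 block diagonal
matrices / direct sums). [cite: HornJohnson2013, §0.9.2 (p0058) with 1.1.P4 (p0076)] -/
theorem dotProduct_mulVec_eq_sum_blocks (A : Matrix ι ι ℝ) (c : ι → κ)
    (hblock : ∀ i j, c i ≠ c j → A i j = 0) (x : ι → ℝ) :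
    x ⬝ᵥ A *ᵥ x = ∑ k, (fun i : {i // c i = k} => x i) ⬝ᵥ
      (A.submatrix (Subtype.val : {i // c i = k} → ι) Subtype.val) *ᵥ (fun i : {i // c i = k} => x i) := by
  simp only [dotProduct, mulVec, submatrix_apply]
  rw [← Fintype.sum_fiberwise c (fun i => x i * ∑ j, A i j * x j)]
  refine Finset.sum_congr rfl fun k _ => Finset.sum_congr rfl fun i _ => ?_
  congr 1
  exact sum_eq_sum_subtype _ fun j hj => by rw [hblock _ _ (fun h => hj (h ▸ i.2)), zero_mul]

/-- **Upper bound from the blocks' quadratic forms**: if `yᵀ A[k] y ≤ B·yᵀy` for every block `k` and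
every `y`, then `λ↓₀(A) ≤ B` (Rayleigh: `λ↓₀(A) = xᵀAx` at a unit top eigenvector, split over the blocks).
[cite: HornJohnson2013, Thm 4.2.2 (c) (p0303) with 1.1.P4 (p0076)] -/
theorem eigenvalues₀_zero_le_of_blocks {A : Matrix ι ι ℝ} (hA : A.IsHermitian)
    (hn : 1 ≤ Fintype.card ι) (c : ι → κ) (hblock : ∀ i j, c i ≠ c j → A i j = 0) (B : ℝ)
    (hB : ∀ k (y : {i // c i = k} → ℝ),
      y ⬝ᵥ (A.submatrix (Subtype.val : {i // c i = k} → ι) Subtype.val) *ᵥ y ≤ B * (y ⬝ᵥ y)) :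
    hA.eigenvalues₀ (Fin.castLE hn 0) ≤ B := by
  obtain ⟨h, horth, -, hsum⟩ := exists_frame_sum_rayleigh_eq hA hn
  have h1 : h 0 ⬝ᵥ h 0 = 1 := by simpa using horth 0 0
  have hq : h 0 ⬝ᵥ A *ᵥ h 0 = hA.eigenvalues₀ (Fin.castLE hn 0) := by
    have := hsum
    simp only [Finset.univ_unique, Fin.default_eq_zero, Finset.sum_singleton] at this
    exact this
  rw [← hq, dotProduct_mulVec_eq_sum_blocks A c hblock (h 0)]
  calc ∑ k, (fun i : {i // c i = k} => h 0 i) ⬝ᵥ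
          (A.submatrix (Subtype.val : {i // c i = k} → ι) Subtype.val) *ᵥ (fun i : {i // c i = k} => h 0 i)
      ≤ ∑ k, B * ((fun i : {i // c i = k} => h 0 i) ⬝ᵥ (fun i : {i // c i = k} => h 0 i)) :=
        Finset.sum_le_sum fun k _ => hB k _
    _ = B * (h 0 ⬝ᵥ h 0) := by rw [← Finset.mul_sum, ← dotProduct_eq_sum_blocks c (h 0) (h 0)]
    _ = B := by rw [h1, mul_one]

/-- **Upper bound from the blocks' top eigenvalues**: if every non-empty block has top eigenvalue
`≤ B`, then `λ↓₀(A) ≤ B` (empty blocks impose nothing). [cite: HornJohnson2013, 1.1.P4 (p0076) with Thm 4.2.2 (c) (p0303)] -/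
theorem eigenvalues₀_zero_le_of_block_tops {A : Matrix ι ι ℝ} (hA : A.IsHermitian)
    (hn : 1 ≤ Fintype.card ι) (c : ι → κ) (hblock : ∀ i j, c i ≠ c j → A i j = 0) (B : ℝ)
    (hB : ∀ k (hk : 1 ≤ Fintype.card {i // c i = k}),
      (hA.submatrix (Subtype.val : {i // c i = k} → ι)).eigenvalues₀ (Fin.castLE hk 0) ≤ B) :
    hA.eigenvalues₀ (Fin.castLE hn 0) ≤ B := by
  refine eigenvalues₀_zero_le_of_blocks hA hn c hblock B fun k y => ?_
  by_cases hk : 1 ≤ Fintype.card {i // c i = k}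
  · have hyy : 0 ≤ y ⬝ᵥ y := by
      rw [dotProduct]; exact Finset.sum_nonneg fun i _ => mul_self_nonneg _
    exact (dotProduct_mulVec_le_eigenvalues₀_max_mul (hA.submatrix Subtype.val) hk y).trans
      (mul_le_mul_of_nonneg_right (hB k hk) hyy)
  · have he : IsEmpty {i // c i = k} := Fintype.card_eq_zero_iff.1 (by omega)
    simp [dotProduct]

omit [Fintype κ] in
/-- **Each non-empty block's top eigenvalue is at most the top eigenvalue of `A`** (Cauchy interlacing
for the principal submatrix on the fibre; no block structure is needed for this direction).
[cite: HornJohnson2013, Thm 4.3.28 (p0315)] -/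
theorem block_top_le_eigenvalues₀_zero {A : Matrix ι ι ℝ} (hA : A.IsHermitian)
    (hn : 1 ≤ Fintype.card ι) (c : ι → κ) (k : κ) (hk : 1 ≤ Fintype.card {i // c i = k}) :
    (hA.submatrix (Subtype.val : {i // c i = k} → ι)).eigenvalues₀ (Fin.castLE hk 0) ≤
      hA.eigenvalues₀ (Fin.castLE hn 0) := by
  have h := eigenvalues₀_submatrix_le hA (Function.Embedding.subtype fun i => c i = k)
    (hA.submatrix Subtype.val) (Fin.castLE hk 0)
  exact h.trans (le_of_eq (congrArg hA.eigenvalues₀ (Fin.ext rfl)))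

/-- **Certificate form (sector top from block tops).** If one non-empty block's top eigenvalue is
`≥ lo` and every non-empty block's top eigenvalue is `≤ hi`, then `λ↓₀(A) ∈ [lo, hi]` — with
`lo = max loₖ` (attained at `k₀`) and `hi = max hiₖ` of certified block-top enclosures this is the
enclosure of the sector's top eigenvalue. [cite: HornJohnson2013, 1.1.P4 (p0076) with Thm 4.2.2 (c), Thm 4.3.28] -/
theorem eigenvalues₀_zero_mem_Icc_of_block_tops {A : Matrix ι ι ℝ} (hA : A.IsHermitian)
    (hn : 1 ≤ Fintype.card ι) (c : ι → κ) (hblock : ∀ i j, c i ≠ c j → A i j = 0) {lo hi : ℝ}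
    (k₀ : κ) (hk₀ : 1 ≤ Fintype.card {i // c i = k₀})
    (hlo : lo ≤ (hA.submatrix (Subtype.val : {i // c i = k₀} → ι)).eigenvalues₀ (Fin.castLE hk₀ 0))
    (hhi : ∀ k (hk : 1 ≤ Fintype.card {i // c i = k}),
      (hA.submatrix (Subtype.val : {i // c i = k} → ι)).eigenvalues₀ (Fin.castLE hk 0) ≤ hi) :
    hA.eigenvalues₀ (Fin.castLE hn 0) ∈ Set.Icc lo hi :=
  ⟨hlo.trans (block_top_le_eigenvalues₀_zero hA hn c k₀ hk₀),
    eigenvalues₀_zero_le_of_block_tops hA hn c hblock hi hhi⟩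


/-! ### §2 The second eigenvalue of a block-diagonal matrix

For the runner-up `λ↓₁(A)` ("largest non-vacuum level of a sector"): it is at most `H` as soon as
`H` bounds the SECOND eigenvalue of one block `k₀` and the TOP eigenvalue of every other block
(Courant–Fischer with one constraint: the zero-padded top eigenvector of `A[k₀]`), and it is at least
the second eigenvalue of any block (interlacing) and at least the smaller of the tops of any two
distinct blocks (a two-dimensional test space of padded block eigenvectors). -/

omit [DecidableEq ι] [Fintype κ] in
/-- A sum over `ι` of a function supported on the fibre `{i // c i = k}` is the sum over the fibre
(dependent version: the summand may use the membership proof). [folklore] -/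
private theorem sum_dite_fiber (c : ι → κ) (k : κ) (g : {i // c i = k} → ℝ) :
    ∑ i, (if h : c i = k then g ⟨i, h⟩ else 0) = ∑ i : {i // c i = k}, g i := by
  rw [sum_eq_sum_subtype (p := fun i => c i = k) _ (fun i hi => by rw [dif_neg hi])]
  exact Finset.sum_congr rfl fun i _ => by rw [dif_pos i.2]

omit [DecidableEq ι] [Fintype κ] in
/-- Dot product of a zero-padded block vector with any `x`: `pad(y) ⬝ x = y ⬝ x|ₖ`. [folklore] -/
private theorem pad_dotProduct (c : ι → κ) (k : κ) (y : {i // c i = k} → ℝ) (x : ι → ℝ) :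
    (fun i => if h : c i = k then y ⟨i, h⟩ else 0) ⬝ᵥ x = y ⬝ᵥ (fun i : {i // c i = k} => x i) := by
  simp only [dotProduct]
  rw [← sum_dite_fiber c k (fun i => y i * x i)]
  exact Finset.sum_congr rfl fun i _ => by by_cases h : c i = k <;> simp [h]

omit [DecidableEq ι] in
/-- Squared norms are nonnegative (dot-product form). [folklore] -/
private theorem dotProduct_self_nonneg' {α : Type*} [Fintype α] (y : α → ℝ) : 0 ≤ y ⬝ᵥ y := by
  rw [dotProduct]; exact Finset.sum_nonneg fun i _ => mul_self_nonneg _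

/-- **Upper bound for the second eigenvalue of a block-diagonal matrix.** If `H` bounds the second
eigenvalue of the block `k₀` (when that block has at least two indices) and the top eigenvalue of every
other non-empty block, then `λ↓₁(A) ≤ H` (Courant–Fischer (4.2.8) with the single constraint
"orthogonal to the zero-padded top eigenvector of `A[k₀]`", the form split over the blocks).
[cite: HornJohnson2013, Thm 4.2.6 (p0305) with 1.1.P4 (p0076)] -/
theorem eigenvalues₀_one_le_of_blocks {A : Matrix ι ι ℝ} (hA : A.IsHermitian)
    (hn : 2 ≤ Fintype.card ι) (c : ι → κ) (hblock : ∀ i j, c i ≠ c j → A i j = 0) (k₀ : κ)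
    (H : ℝ)
    (hH₀ : ∀ hk : 2 ≤ Fintype.card {i // c i = k₀},
      (hA.submatrix (Subtype.val : {i // c i = k₀} → ι)).eigenvalues₀ ⟨1, hk⟩ ≤ H)
    (hH : ∀ k, k ≠ k₀ → ∀ hk : 1 ≤ Fintype.card {i // c i = k},
      (hA.submatrix (Subtype.val : {i // c i = k} → ι)).eigenvalues₀ (Fin.castLE hk 0) ≤ H) :
    hA.eigenvalues₀ ⟨1, hn⟩ ≤ H := by
  have hB₀h : (A.submatrix (Subtype.val : {i // c i = k₀} → ι) Subtype.val).IsHermitian :=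
    hA.submatrix Subtype.val
  -- one constraint vector on the block k₀ under which the block's form is ≤ H · (y ⬝ y)
  have hcon : ∃ w : {i // c i = k₀} → ℝ, ∀ y : {i // c i = k₀} → ℝ, w ⬝ᵥ y = 0 →
      y ⬝ᵥ (A.submatrix (Subtype.val : {i // c i = k₀} → ι) Subtype.val) *ᵥ y ≤ H * (y ⬝ᵥ y) := by
    by_cases hk2 : 2 ≤ Fintype.card {i // c i = k₀}
    · obtain ⟨w, hw⟩ := exists_constraints_rayleigh_le hB₀h ⟨1, hk2⟩
      refine ⟨w 0, fun y hy => (hw y fun i => ?_).trans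
        (mul_le_mul_of_nonneg_right (hH₀ hk2) (dotProduct_self_nonneg' y))⟩
      have : i = 0 := Subsingleton.elim _ _
      subst this; exact hy
    · refine ⟨fun _ => 1, fun y hy => ?_⟩
      -- at most one index: `y ⊥ 1` forces `y = 0`
      have hsub : Subsingleton {i // c i = k₀} := Fintype.card_le_one_iff_subsingleton.1 (by omega)
      have hy0 : y = 0 := by
        funext i
        have h1 : (fun _ => (1 : ℝ)) ⬝ᵥ y = ∑ j, y j := by simp [dotProduct]
        rw [h1, Fintype.sum_eq_single i (fun j hj => absurd (Subsingleton.elim j i) hj)] at hy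
        exact hy
      subst hy0; simp
  obtain ⟨w, hw⟩ := hcon
  -- Courant–Fischer at index 1 with the padded constraint
  obtain ⟨x, hx0, hxw, hxge⟩ := exists_orthogonal_rayleigh_ge hA ⟨1, hn⟩
    (fun _ : Fin 1 => fun i => if h : c i = k₀ then w ⟨i, h⟩ else 0)
  have hpos : 0 < x ⬝ᵥ x :=
    lt_of_le_of_ne (dotProduct_self_nonneg' x) (Ne.symm fun h => hx0 (dotProduct_self_eq_zero.1 h))
  have hform : x ⬝ᵥ A *ᵥ x ≤ H * (x ⬝ᵥ x) := by
    rw [dotProduct_mulVec_eq_sum_blocks A c hblock x, dotProduct_eq_sum_blocks c x x, Finset.mul_sum]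
    refine Finset.sum_le_sum fun k _ => ?_
    have hnn := dotProduct_self_nonneg' (fun i : {i // c i = k} => x i)
    by_cases hk : k = k₀
    · subst hk
      refine hw _ ?_
      have := hxw 0
      rwa [pad_dotProduct] at this
    · by_cases hk1 : 1 ≤ Fintype.card {i // c i = k}
      · exact (dotProduct_mulVec_le_eigenvalues₀_max_mul (hA.submatrix Subtype.val) hk1 _).trans
          (mul_le_mul_of_nonneg_right (hH k hk hk1) hnn)
      · have he : IsEmpty {i // c i = k} := Fintype.card_eq_zero_iff.1 (by omega)
        simp [dotProduct]
  exact le_of_mul_le_mul_right (hxge.trans hform) hpos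

omit [Fintype κ] in
/-- **Lower bound (i)**: the second eigenvalue of any block with at least two indices is at most
`λ↓₁(A)` (Cauchy interlacing). [cite: HornJohnson2013, Thm 4.3.28 (p0315)] -/
theorem block_second_le_eigenvalues₀_one {A : Matrix ι ι ℝ} (hA : A.IsHermitian)
    (hn : 2 ≤ Fintype.card ι) (c : ι → κ) (k : κ) (hk : 2 ≤ Fintype.card {i // c i = k}) :
    (hA.submatrix (Subtype.val : {i // c i = k} → ι)).eigenvalues₀ ⟨1, hk⟩ ≤
      hA.eigenvalues₀ ⟨1, hn⟩ := by
  have h := eigenvalues₀_submatrix_le hA (Function.Embedding.subtype fun i => c i = k)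
    (hA.submatrix Subtype.val) ⟨1, hk⟩
  exact h.trans (le_of_eq (congrArg hA.eigenvalues₀ (Fin.ext rfl)))

/-- **Lower bound (ii)**: for two DISTINCT non-empty blocks `k ≠ k'`, any common lower bound `m` of
their top eigenvalues is at most `λ↓₁(A)` (the zero-padded unit top eigenvectors `U`, `V` of the two
blocks have disjoint supports; some non-zero `aU + bV` satisfies the single Courant–Fischer constraint of
(4.2.8) at index 1, and its Rayleigh quotient is `(a²μ + b²ν)/(a² + b²) ≥ m`).
[cite: HornJohnson2013, Thm 4.2.6 (p0305) with 1.1.P4 (p0076)] -/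
theorem le_eigenvalues₀_one_of_two_block_tops {A : Matrix ι ι ℝ} (hA : A.IsHermitian)
    (hn : 2 ≤ Fintype.card ι) (c : ι → κ) (hblock : ∀ i j, c i ≠ c j → A i j = 0)
    {k k' : κ} (hkk : k ≠ k') (hk : 1 ≤ Fintype.card {i // c i = k})
    (hk' : 1 ≤ Fintype.card {i // c i = k'}) {m : ℝ}
    (hm : m ≤ (hA.submatrix (Subtype.val : {i // c i = k} → ι)).eigenvalues₀ (Fin.castLE hk 0))
    (hm' : m ≤ (hA.submatrix (Subtype.val : {i // c i = k'} → ι)).eigenvalues₀ (Fin.castLE hk' 0)) :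
    m ≤ hA.eigenvalues₀ ⟨1, hn⟩ := by
  obtain ⟨u, hu1, -, husum⟩ :=
    exists_frame_sum_rayleigh_eq (hA.submatrix (Subtype.val : {i // c i = k} → ι)) hk
  obtain ⟨v, hv1, -, hvsum⟩ :=
    exists_frame_sum_rayleigh_eq (hA.submatrix (Subtype.val : {i // c i = k'} → ι)) hk'
  have hu11 : u 0 ⬝ᵥ u 0 = 1 := by simpa using hu1 0 0
  have hv11 : v 0 ⬝ᵥ v 0 = 1 := by simpa using hv1 0 0
  have huq : u 0 ⬝ᵥ (A.submatrix (Subtype.val : {i // c i = k} → ι) Subtype.val) *ᵥ u 0 =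
      (hA.submatrix (Subtype.val : {i // c i = k} → ι)).eigenvalues₀ (Fin.castLE hk 0) := by
    have := husum
    simp only [Finset.univ_unique, Fin.default_eq_zero, Finset.sum_singleton] at this
    exact this
  have hvq : v 0 ⬝ᵥ (A.submatrix (Subtype.val : {i // c i = k'} → ι) Subtype.val) *ᵥ v 0 =
      (hA.submatrix (Subtype.val : {i // c i = k'} → ι)).eigenvalues₀ (Fin.castLE hk' 0) := by
    have := hvsum
    simp only [Finset.univ_unique, Fin.default_eq_zero, Finset.sum_singleton] at this
    exact this
  -- padded vectors and the Courant–Fischer constraint at index 1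
  set U : ι → ℝ := fun i => if h : c i = k then u 0 ⟨i, h⟩ else 0 with hU
  set V : ι → ℝ := fun i => if h : c i = k' then v 0 ⟨i, h⟩ else 0 with hV
  obtain ⟨w, hw⟩ := exists_constraints_rayleigh_le hA ⟨1, hn⟩
  obtain ⟨a, b, hab, habw⟩ : ∃ a b : ℝ, (a ≠ 0 ∨ b ≠ 0) ∧ a * (w 0 ⬝ᵥ U) + b * (w 0 ⬝ᵥ V) = 0 := by
    by_cases h : w 0 ⬝ᵥ U = 0
    · exact ⟨1, 0, Or.inl one_ne_zero, by rw [h]; ring⟩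
    · exact ⟨w 0 ⬝ᵥ V, -(w 0 ⬝ᵥ U), Or.inr (neg_ne_zero.2 h), by ring⟩
  set x : ι → ℝ := a • U + b • V with hx
  have hxw : ∀ i, w i ⬝ᵥ x = 0 := by
    intro i
    have : i = 0 := Subsingleton.elim _ _
    subst this
    rw [hx, dotProduct_add, dotProduct_smul, dotProduct_smul, smul_eq_mul, smul_eq_mul, habw]
  have hle := hw x hxw          -- xᵀAx ≤ λ↓₁ · xᵀx
  -- block restrictions of x
  have hxk : (fun i : {i // c i = k} => x i) = a • u 0 := by
    funext i
    simp [hx, hU, hV, i.2, hkk]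
  have hxk' : (fun i : {i // c i = k'} => x i) = b • v 0 := by
    funext i
    simp [hx, hU, hV, i.2, hkk.symm]
  have hx0 : ∀ k₁, k₁ ≠ k → k₁ ≠ k' → (fun i : {i // c i = k₁} => x i) = 0 := by
    intro k₁ h1 h2
    funext i
    have h3 : ¬ c (i : ι) = k := fun h => h1 (i.2.symm.trans h)
    have h4 : ¬ c (i : ι) = k' := fun h => h2 (i.2.symm.trans h)
    simp [hx, hU, hV, h3, h4]
  -- termwise: m · ‖x|ₖ₁‖² ≤ (x|ₖ₁)ᵀ A[k₁] (x|ₖ₁)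
  have hterm : ∀ k₁, m * ((fun i : {i // c i = k₁} => x i) ⬝ᵥ (fun i : {i // c i = k₁} => x i)) ≤
      (fun i : {i // c i = k₁} => x i) ⬝ᵥ
        (A.submatrix (Subtype.val : {i // c i = k₁} → ι) Subtype.val) *ᵥ (fun i : {i // c i = k₁} => x i) := by
    intro k₁
    by_cases h1 : k₁ = k
    · subst h1
      rw [hxk, mulVec_smul, dotProduct_smul, smul_dotProduct, smul_dotProduct, dotProduct_smul, huq, hu11]
      simp only [smul_eq_mul]
      nlinarith [mul_nonneg (sub_nonneg.2 hm) (mul_self_nonneg a)]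
    · by_cases h2 : k₁ = k'
      · subst h2
        rw [hxk', mulVec_smul, dotProduct_smul, smul_dotProduct, smul_dotProduct, dotProduct_smul, hvq, hv11]
        simp only [smul_eq_mul]
        nlinarith [mul_nonneg (sub_nonneg.2 hm') (mul_self_nonneg b)]
      · rw [hx0 k₁ h1 h2]; simp
  have hge : m * (x ⬝ᵥ x) ≤ x ⬝ᵥ A *ᵥ x := by
    rw [dotProduct_mulVec_eq_sum_blocks A c hblock x, dotProduct_eq_sum_blocks c x x, Finset.mul_sum]
    exact Finset.sum_le_sum fun k₁ _ => hterm k₁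
  -- x ≠ 0: its squared norm dominates a² (block k) and b² (block k')
  have hxx : x ⬝ᵥ x = ∑ k₁, (fun i : {i // c i = k₁} => x i) ⬝ᵥ (fun i : {i // c i = k₁} => x i) :=
    dotProduct_eq_sum_blocks c x x
  have hpos : 0 < x ⬝ᵥ x := by
    rw [hxx]
    rcases hab with ha | hb
    · refine lt_of_lt_of_le ?_ (Finset.single_le_sum (fun k₁ _ => dotProduct_self_nonneg' _) (mem_univ k))
      rw [hxk, smul_dotProduct, dotProduct_smul, hu11]; simp only [smul_eq_mul, mul_one]; exact mul_self_pos.2 ha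
    · refine lt_of_lt_of_le ?_ (Finset.single_le_sum (fun k₁ _ => dotProduct_self_nonneg' _) (mem_univ k'))
      rw [hxk', smul_dotProduct, dotProduct_smul, hv11]; simp only [smul_eq_mul, mul_one]; exact mul_self_pos.2 hb
  exact le_of_mul_le_mul_right (hge.trans hle) hpos

end BlockDiagonalTop

end Literature.Analysis.Matrix
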